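/-
Copyright (c) 2026 the pub-hodgecm-mathlib formalisation cell (harness21).  Prover seat hodgecm-mathlib-LH4-p06 (g4), Track A «(D-RAM) FOUR-FRAME», unit U2H, the census leaf
(ρ2b′-X) `stub_U2H_fixedPointCensus_typeTwo_unit0` — dealer LH4-plan (g12) WORD #16∕#21∕#22 hand T5c «TORIC LEVEL CENSUS, M∕E-RAMIFIED» (payer lineage LH4-p14; plan owner
LH4-p12 (g4); F0P3-p01 (g32) RamM INDEX-LEMMAS (L-RM0)–(L-RM2)): the u-free level sets of the RAMIFIED type as index differences — twin of LH4-p08 (g4)'s type-U organ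
`QuadraticOrderLevelClasses`.  2026-09-04.
-/
import Literature.NumberTheory.LocalFields.QuadraticOrderLatticeClasses          -- ★ p857298 (LH4-p08 (g4), F1): lattices ↔ cosets, coset bookkeeping
import Literature.NumberTheory.LocalFields.QuadraticOrderNormTwistClasses        -- ★ p857299 (LH4-p08 (g4)): twist `t`, `B_r`, translation lemma → ★ p857226 (`|y − ρy| = |y|·|1 + ηt|`)
import Literature.NumberTheory.LocalFields.QuadraticOrderHermitianLevelRamified  -- ★ p857267 (this seat): the RAMIFIED integral ∧ Gram-primitive dichotomy with parity (L-RM1)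
import HarnessLib

/-!
# The u-free LEVEL SETS of the toric census when `M ∕ E` is RAMIFIED, as index differences:
# `#{x₀𝒪_j : integral, Gram-primitive, |y| = |ϖE|^a} = [B : 𝒪_jˣ] − [B′ : 𝒪_jˣ]` (`a ≥ 1`), `= [B : 𝒪_jˣ]` (`a = 0`), `= 0` (no level-`a` generator ∕ no translator)
(Flicker 1998 p. 84 (Mars); Serre, *Local Fields* Ch. V §1–§3; Jacobowitz 1962 §4)

Topic `NumberTheory/LocalFields`; namespace `Literature.NumberTheory.LocalFields.QuadraticOrder` (= ★ T4, ★ F1∕F4 organs of LH4-p08 (g4), ★ p857267∕p857268∕p857313∕p857338 of this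
seat).  THEOREMS ONLY (no definition, no instance, no notation, no named fact, no `sorry`); kernel lane `--supports stmt-HodgeConjecture-24833` (count-neutral).  Cell
`pub/hodgecm-mathlib` (D-0151), crux H413, Track A «(D-RAM) FOUR-FRAME», unit U2H: the T5c sheet (`T5cToricLevelCensusRamM.statements.v5`, over ★ DEFS p857239) counts
`levelSet j a` = the order lattices `x₀·𝒪_j` (conductor `ϖE^j`, `ϖE` the `ρ`-fixed uniformiser of `E`, `|ϖE| = exp(−2)` on `M`) whose dual generator
`y = h·x₀Θx₀·ϖE^j(α − ρα)` is INTEGRAL, GRAM-PRIMITIVE and of LEVEL `|y| = |ϖE|^a`.  DIFFERENCE WITH TYPE U (★ `QuadraticOrderLevelClasses`, M∕E unramified): the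
uniformiser `α` of `M` (`|α| = exp(−1)`, `|α − ρα| = exp(−d_ρ)`) is NOT `ρ`-fixed, so the generator normal form is `x₀ = α^k·ω` and the twist picks up the factor
`t(α^k) = ρ(α^kΘα^k)∕(α^kΘα^k)` (`= (ρε∕ε)^k`, `ε = αΘα∕ϖE` — F0P3-p01 (g32) (L-RM0) «two class rows»); the level equation is `v_h + d_ρ + 2k + 2j = 2a` (ONE `k` per `a`;
no lattice at all unless `v_h + d_ρ` is even); and the integral ∧ primitive test is this seat's ★ PARITY DICHOTOMY `order_and_not_order_div_iff_of_even` (ρ-fixed elements of even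
valuation) in place of ★ p857226's unramified one.  With these three substitutions the reduction is LH4-p08 (g4)'s, step for step:
* §1 `normTwist_mul` (`t(xy) = t(x)t(y)`), generator normal form `x₀ = α^k·ω`, the LEVEL `|y(α^kω)| = exp(−(v_h + d_ρ + 2k + 2j))`;
* §2 MEMBERSHIP: `x₀ = α^kω` generates a member of the level-`a` set iff `v_h + d_ρ + 2k + 2j = 2a` and — `a ≥ 1`: `|1 + η·t(α^k)·t(ω)| = exp(2a − 2j − d_ρ)` EXACTLY
  (`η = ρh∕h`); `a = 0`: `|1 + η·t(α^k)·t(ω)| ≤ exp(−(2j + d_ρ))`;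
* §3 THE GENERATOR SETS in `Mˣ`: `α^{k₀}·{ω : |ω| = 1, |1 + (η·t(α^{k₀}))·t(ω)| = X}` (resp. `≤`), EMPTY when the level equation has no solution, and the exact-depth set as
  a difference of two depth sets; the COUNTS (index differences over ★ F1 + the ★ translation lemma) are the sequel `QuadraticOrderLevelCountsRamified`.
HONEST LABEL: HC_CM is proved only modulo the 7 printed citations (2 remaining named inputs: hLiu418 = stmt-HodgeConjecture-24832, h413 = stmt-HodgeConjecture-24833) until rung 0
closes; unconditional algebra, count-neutral (organ of the RamM census; the census VALUE appears only when indices and membership rows are substituted, in the Theorems head).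

## References
* [Flicker1998UnitaryFL] Y. Z. Flicker, *Elementary proof of the fundamental lemma for a unitary group*, Canad. J. Math. 50 (1998): p. 84 REMARK (Mars' orders and lattices `z·R_E(j)`).
* [Serre1979] J.-P. Serre, *Local Fields*, GTM 67 (1979): Ch. V §1, §3.
* [Jacobowitz1962] R. Jacobowitz, *Hermitian forms over local fields*, Amer. J. Math. 84 (1962): §4.
-/

set_option autoImplicit false

open WithZero
open scoped Pointwise

namespace Literature.NumberTheory.LocalFields.QuadraticOrder

variable {K : Type*} [Field K] [Valued K ℤᵐ⁰] {ρ Θ : K →+* K} {α ϖE h : K} {dρ : ℕ}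

/-! ## §1 Twist multiplicativity, generator normal form `x₀ = α^k·ω`, the level -/

omit [Valued K ℤᵐ⁰] in
/-- **THE TWIST IS MULTIPLICATIVE**: `t(xy) = t(x)·t(y)` for `t(x) = ρ(xΘx)∕(xΘx)` (`x, y ≠ 0`). [cite: Jacobowitz1962, §4] -/
theorem normTwist_mul {x y : K} (hx : x ≠ 0) (hy : y ≠ 0) :
    ρ (x * y * Θ (x * y)) / (x * y * Θ (x * y)) = (ρ (x * Θ x) / (x * Θ x)) * (ρ (y * Θ y) / (y * Θ y)) := by
  have hΘx : Θ x ≠ 0 := (map_ne_zero Θ).2 hx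
  have hΘy : Θ y ≠ 0 := (map_ne_zero Θ).2 hy
  rw [show x * y * Θ (x * y) = (x * Θ x) * (y * Θ y) by rw [map_mul]; ring, map_mul ρ]
  field_simp

/-- `|α| = exp(−1)` is non-zero and `|α^k| = exp(−k)` (`k ∈ ℤ`). [cite: Serre1979, Ch. V §1] -/
theorem ne_zero_and_v_zpow_of_v_eq (hα : Valued.v α = exp (-1 : ℤ)) (k : ℤ) : α ≠ 0 ∧ Valued.v (α ^ k) = exp (-k) := by
  have hα0 : α ≠ 0 := fun h0 => by rw [h0, map_zero] at hα; exact (exp_ne_zero hα.symm).elim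
  refine ⟨hα0, ?_⟩
  rw [map_zpow₀, hα, ← exp_zsmul, smul_eq_mul, mul_neg, mul_one]

/-- **GENERATOR NORMAL FORM on the M-uniformiser**: every `x₀ ≠ 0` is `α^k·ω` with `|ω| = 1`. [cite: Serre1979, Ch. V §1] -/
theorem exists_eq_uniformizer_zpow_mul_unit (hα : Valued.v α = exp (-1 : ℤ)) {x₀ : K} (hx₀ : x₀ ≠ 0) :
    ∃ (k : ℤ) (ω : K), Valued.v ω = 1 ∧ x₀ = α ^ k * ω := by
  obtain ⟨hα0, -⟩ := ne_zero_and_v_zpow_of_v_eq hα 0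
  have hv0 : Valued.v x₀ ≠ 0 := (Valuation.ne_zero_iff _).2 hx₀
  obtain ⟨n, hn⟩ : ∃ n : ℤ, Valued.v x₀ = exp n := ⟨_, (exp_log hv0).symm⟩
  refine ⟨-n, α ^ n * x₀, ?_, ?_⟩
  · rw [map_mul, (ne_zero_and_v_zpow_of_v_eq hα n).2, hn, ← exp_add, neg_add_cancel, exp_zero]
  · rw [← mul_assoc, ← zpow_add₀ hα0, neg_add_cancel, zpow_zero, one_mul]

/-- **THE LEVEL OF `α^k·ω` IN THE RAMIFIED FRAME**: `|y| = exp(−(v_h + d_ρ + 2k + 2j))` for `y = h·(x₀Θx₀)·(ϖE^j(α − ρα))`, `x₀ = α^kω`, `|ω| = 1`, `|h| = exp(−v_h)`,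
`|α − ρα| = exp(−d_ρ)`, `|ϖE| = exp(−2)`, `Θ` isometric. [cite: Jacobowitz1962, §4] -/
theorem v_hermGenR_zpow_mul (hvΘ : ∀ x, Valued.v (Θ x) = Valued.v x) (hα : Valued.v α = exp (-1 : ℤ)) (hdρ : Valued.v (α - ρ α) = exp (-(dρ : ℤ)))
    (hϖE : Valued.v ϖE = exp (-2 : ℤ)) {vh : ℤ} (hvh : Valued.v h = exp (-vh)) (j : ℕ) {k : ℤ} {ω : K} (hω : Valued.v ω = 1) :
    Valued.v (h * (α ^ k * ω * Θ (α ^ k * ω)) * (ϖE ^ j * (α - ρ α))) = exp (-(vh + dρ + 2 * k + 2 * j)) := by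
  obtain ⟨-, hk⟩ := ne_zero_and_v_zpow_of_v_eq hα k
  have hj : Valued.v (ϖE ^ j) = exp (-(2 * (j : ℤ))) := by
    rw [map_pow, hϖE, ← exp_nsmul]; congr 1; simp only [nsmul_eq_mul]; ring
  simp only [map_mul, hvΘ, hk, hω, hvh, hj, hdρ, mul_one, ← exp_add]
  congr 1; ring

/-- The level token `|ϖE|^a = exp(−2a)`. [cite: Serre1979, Ch. V §1] -/
theorem v_varpiE_pow (hϖE : Valued.v ϖE = exp (-2 : ℤ)) (a : ℕ) : Valued.v ϖE ^ a = exp (-(2 * (a : ℤ))) := by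
  rw [hϖE, ← exp_nsmul]; congr 1; simp only [nsmul_eq_mul]; ring

/-- The order bound of conductor `ϖE^j` in the ramified frame: `|ϖE^j·(α − ρα)| = exp(−(2j + d_ρ))`. [cite: Serre1979, Ch. III §6 Prop. 12] -/
theorem v_conductorR (hdρ : Valued.v (α - ρ α) = exp (-(dρ : ℤ))) (hϖE : Valued.v ϖE = exp (-2 : ℤ)) (j : ℕ) :
    Valued.v (ϖE ^ j * (α - ρ α)) = exp (-(2 * (j : ℤ) + dρ)) := by
  rw [map_mul, map_pow, hϖE, hdρ, ← exp_nsmul, ← exp_add]; congr 1; simp only [nsmul_eq_mul]; ring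

/-! ## §2 Membership of the level-`a` set in generator normal form (ramified frame, parity dichotomy) -/

/-- **MEMBERSHIP, `a ≥ 1` (RamM)**: for `x₀ = α^kω` (`|ω| = 1`) the dual generator `y = h·(x₀Θx₀)·(ϖE^j(α − ρα))` is integral and Gram-primitive of level `|y| = |ϖE|^a`, `1 ≤ a`,
iff `v_h + d_ρ + 2k + 2j = 2a` and `|1 + η·t(α^k)·t(ω)| = exp(2a − 2j − d_ρ)` EXACTLY (`η = ρh∕h`, `t(x) = ρ(xΘx)∕(xΘx)`; ★ p857267 parity dichotomy + ★ p857226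
`|y − ρy| = |y|·|1 + η·t(x₀)|` + `t(α^kω) = t(α^k)t(ω)`). [cite: Jacobowitz1962, §4] [cite: Serre1979, Ch. V §3] -/
theorem hermGenR_level_iff_of_pos (hρρ : ∀ x, ρ (ρ x) = x) (hvΘ : ∀ x, Valued.v (Θ x) = Valued.v x)
    (hfix : ∀ c : K, ρ c = c → c ≠ 0 → ∃ n : ℤ, Valued.v c = exp (2 * n)) (hρα : ρ α ≠ α)
    (hα : Valued.v α = exp (-1 : ℤ)) (hdρ : Valued.v (α - ρ α) = exp (-(dρ : ℤ))) (hϖE : Valued.v ϖE = exp (-2 : ℤ)) (hρϖ : ρ ϖE = ϖE)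
    (hh : h ≠ 0) {vh : ℤ} (hvh : Valued.v h = exp (-vh)) (j : ℕ) {a : ℕ} (ha : 1 ≤ a) {k : ℤ} {ω : K} (hω : Valued.v ω = 1) :
    (((Valued.v (h * (α ^ k * ω * Θ (α ^ k * ω)) * (ϖE ^ j * (α - ρ α))) ≤ 1 ∧
          Valued.v (h * (α ^ k * ω * Θ (α ^ k * ω)) * (ϖE ^ j * (α - ρ α)) - ρ (h * (α ^ k * ω * Θ (α ^ k * ω)) * (ϖE ^ j * (α - ρ α)))) ≤
            Valued.v (ϖE ^ j * (α - ρ α))) ∧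
        ¬ (Valued.v (h * (α ^ k * ω * Θ (α ^ k * ω)) * (ϖE ^ j * (α - ρ α)) / ϖE) ≤ 1 ∧
            Valued.v (h * (α ^ k * ω * Θ (α ^ k * ω)) * (ϖE ^ j * (α - ρ α)) / ϖE - ρ (h * (α ^ k * ω * Θ (α ^ k * ω)) * (ϖE ^ j * (α - ρ α)) / ϖE)) ≤
              Valued.v (ϖE ^ j * (α - ρ α)))) ∧
      Valued.v (h * (α ^ k * ω * Θ (α ^ k * ω)) * (ϖE ^ j * (α - ρ α))) = Valued.v ϖE ^ a) ↔
    (vh + dρ + 2 * k + 2 * j = 2 * a ∧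
      Valued.v (1 + ρ h / h * ((ρ (α ^ k * Θ (α ^ k)) / (α ^ k * Θ (α ^ k))) * (ρ (ω * Θ ω) / (ω * Θ ω)))) = exp (2 * (a : ℤ) - 2 * j - dρ)) := by
  obtain ⟨hα0, hk⟩ := ne_zero_and_v_zpow_of_v_eq hα k
  have hω0 : ω ≠ 0 := fun h0 => by rw [h0, map_zero] at hω; exact zero_ne_one hω
  have hx₀ : α ^ k * ω ≠ 0 := mul_ne_zero (zpow_ne_zero k hα0) hω0
  have hΘx₀ : Θ (α ^ k * ω) ≠ 0 := (map_ne_zero Θ).2 hx₀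
  have hρc : ρ (ϖE ^ j) = ϖE ^ j := by rw [map_pow, hρϖ]
  have hlev := v_hermGenR_zpow_mul (ρ := ρ) hvΘ hα hdρ hϖE hvh j (k := k) hω
  have hr := v_conductorR (ρ := ρ) hdρ hϖE j
  have hpa := v_varpiE_pow hϖE a
  have htw : ρ (α ^ k * ω * Θ (α ^ k * ω)) / (α ^ k * ω * Θ (α ^ k * ω)) =
      (ρ (α ^ k * Θ (α ^ k)) / (α ^ k * Θ (α ^ k))) * (ρ (ω * Θ ω) / (ω * Θ ω)) := normTwist_mul (zpow_ne_zero k hα0) hω0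
  have hsub := v_hermGen_sub_map_eq (Θ := Θ) (α := α) hρρ hρc hh hx₀ hΘx₀
  rw [htw] at hsub
  constructor
  · rintro ⟨hP, hL⟩
    have hkj : vh + dρ + 2 * k + 2 * j = 2 * a := by
      have := hL; rw [hlev, hpa, exp_inj] at this; omega
    refine ⟨hkj, ?_⟩
    rcases (order_and_not_order_div_iff_of_even hρρ hρα hfix hϖE hρϖ hL j).1 hP with ⟨h0, -⟩ | ⟨-, heq⟩
    · exfalso; omega
    · rw [hsub, hL, hpa, hr] at heq
      -- `exp(−2a)·X = exp(−(2j+dρ))`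
      have hne : exp (-(2 * (a : ℤ))) ≠ 0 := exp_ne_zero
      have hX : Valued.v (1 + ρ h / h * ((ρ (α ^ k * Θ (α ^ k)) / (α ^ k * Θ (α ^ k))) * (ρ (ω * Θ ω) / (ω * Θ ω)))) =
          exp (-(2 * (j : ℤ) + dρ)) / exp (-(2 * (a : ℤ))) := (eq_div_iff hne).2 (by rw [mul_comm]; exact heq)
      rw [hX, ← exp_sub]; congr 1; ring
  · rintro ⟨hkj, hX⟩
    have hL : Valued.v (h * (α ^ k * ω * Θ (α ^ k * ω)) * (ϖE ^ j * (α - ρ α))) = Valued.v ϖE ^ a := by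
      rw [hlev, hpa]; congr 1; omega
    refine ⟨(order_and_not_order_div_iff_of_even hρρ hρα hfix hϖE hρϖ hL j).2 (Or.inr ⟨ha, ?_⟩), hL⟩
    rw [hsub, hL, hpa, hX, hr, ← exp_add]; congr 1; ring

/-- **MEMBERSHIP, `a = 0` (RamM)**: `x₀ = α^kω` generates an integral Gram-primitive lattice of level `0` iff `v_h + d_ρ + 2k + 2j = 0` and
`|1 + η·t(α^k)·t(ω)| ≤ exp(−(2j + d_ρ))`. [cite: Jacobowitz1962, §4] [cite: Serre1979, Ch. V §3] -/
theorem hermGenR_level_iff_zero (hρρ : ∀ x, ρ (ρ x) = x) (hvΘ : ∀ x, Valued.v (Θ x) = Valued.v x)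
    (hfix : ∀ c : K, ρ c = c → c ≠ 0 → ∃ n : ℤ, Valued.v c = exp (2 * n)) (hρα : ρ α ≠ α)
    (hα : Valued.v α = exp (-1 : ℤ)) (hdρ : Valued.v (α - ρ α) = exp (-(dρ : ℤ))) (hϖE : Valued.v ϖE = exp (-2 : ℤ)) (hρϖ : ρ ϖE = ϖE)
    (hh : h ≠ 0) {vh : ℤ} (hvh : Valued.v h = exp (-vh)) (j : ℕ) {k : ℤ} {ω : K} (hω : Valued.v ω = 1) :
    (((Valued.v (h * (α ^ k * ω * Θ (α ^ k * ω)) * (ϖE ^ j * (α - ρ α))) ≤ 1 ∧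
          Valued.v (h * (α ^ k * ω * Θ (α ^ k * ω)) * (ϖE ^ j * (α - ρ α)) - ρ (h * (α ^ k * ω * Θ (α ^ k * ω)) * (ϖE ^ j * (α - ρ α)))) ≤
            Valued.v (ϖE ^ j * (α - ρ α))) ∧
        ¬ (Valued.v (h * (α ^ k * ω * Θ (α ^ k * ω)) * (ϖE ^ j * (α - ρ α)) / ϖE) ≤ 1 ∧
            Valued.v (h * (α ^ k * ω * Θ (α ^ k * ω)) * (ϖE ^ j * (α - ρ α)) / ϖE - ρ (h * (α ^ k * ω * Θ (α ^ k * ω)) * (ϖE ^ j * (α - ρ α)) / ϖE)) ≤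
              Valued.v (ϖE ^ j * (α - ρ α)))) ∧
      Valued.v (h * (α ^ k * ω * Θ (α ^ k * ω)) * (ϖE ^ j * (α - ρ α))) = Valued.v ϖE ^ (0 : ℕ)) ↔
    (vh + dρ + 2 * k + 2 * j = 0 ∧
      Valued.v (1 + ρ h / h * ((ρ (α ^ k * Θ (α ^ k)) / (α ^ k * Θ (α ^ k))) * (ρ (ω * Θ ω) / (ω * Θ ω)))) ≤ exp (-(2 * (j : ℤ) + dρ))) := by
  obtain ⟨hα0, hk⟩ := ne_zero_and_v_zpow_of_v_eq hα k
  have hω0 : ω ≠ 0 := fun h0 => by rw [h0, map_zero] at hω; exact zero_ne_one hω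
  have hx₀ : α ^ k * ω ≠ 0 := mul_ne_zero (zpow_ne_zero k hα0) hω0
  have hΘx₀ : Θ (α ^ k * ω) ≠ 0 := (map_ne_zero Θ).2 hx₀
  have hρc : ρ (ϖE ^ j) = ϖE ^ j := by rw [map_pow, hρϖ]
  have hlev := v_hermGenR_zpow_mul (ρ := ρ) hvΘ hα hdρ hϖE hvh j (k := k) hω
  have hr := v_conductorR (ρ := ρ) hdρ hϖE j
  have htw : ρ (α ^ k * ω * Θ (α ^ k * ω)) / (α ^ k * ω * Θ (α ^ k * ω)) =
      (ρ (α ^ k * Θ (α ^ k)) / (α ^ k * Θ (α ^ k))) * (ρ (ω * Θ ω) / (ω * Θ ω)) := normTwist_mul (zpow_ne_zero k hα0) hω0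
  have hsub := v_hermGen_sub_map_eq (Θ := Θ) (α := α) hρρ hρc hh hx₀ hΘx₀
  rw [htw] at hsub
  rw [pow_zero]
  constructor
  · rintro ⟨hP, hL⟩
    have hkj : vh + dρ + 2 * k + 2 * j = 0 := by
      have := hL; rw [hlev, ← exp_zero, exp_inj] at this; omega
    refine ⟨hkj, ?_⟩
    have hL' : Valued.v (h * (α ^ k * ω * Θ (α ^ k * ω)) * (ϖE ^ j * (α - ρ α))) = Valued.v ϖE ^ (0 : ℕ) := by rw [pow_zero]; exact hL
    rcases (order_and_not_order_div_iff_of_even hρρ hρα hfix hϖE hρϖ hL' j).1 hP with ⟨-, hle⟩ | ⟨-, heq⟩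
    · rw [hsub, hL, one_mul, hr] at hle; exact hle
    · rw [hsub, hL, one_mul, hr] at heq; exact heq.le
  · rintro ⟨hkj, hX⟩
    have hL : Valued.v (h * (α ^ k * ω * Θ (α ^ k * ω)) * (ϖE ^ j * (α - ρ α))) = 1 := by
      rw [hlev, ← exp_zero]; congr 1; omega
    have hL' : Valued.v (h * (α ^ k * ω * Θ (α ^ k * ω)) * (ϖE ^ j * (α - ρ α))) = Valued.v ϖE ^ (0 : ℕ) := by rw [pow_zero]; exact hL
    refine ⟨(order_and_not_order_div_iff_of_even hρρ hρα hfix hϖE hρϖ hL' j).2 (Or.inl ⟨rfl, ?_⟩), hL⟩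
    rw [hsub, hL, one_mul, hr]; exact hX

/-! ## §3 The generator sets in `Mˣ` and the counts -/

/-- Discreteness: `|x| = exp n ⟺ |x| ≤ exp n ∧ ¬ |x| ≤ exp(n − 1)`. [cite: Serre1979, Ch. V §1] -/
theorem v_eq_exp_iff_le_and_not_le (x : K) (n : ℤ) : Valued.v x = exp n ↔ Valued.v x ≤ exp n ∧ ¬ Valued.v x ≤ exp (n - 1) := by
  constructor
  · intro h
    refine ⟨h.le, fun h' => ?_⟩
    rw [h, exp_le_exp] at h'; omega
  · rintro ⟨h1, h2⟩
    rw [not_le] at h2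
    rcases eq_or_ne (Valued.v x) 0 with h0 | h0
    · rw [h0] at h2; exact absurd h2 (not_lt.2 zero_le)
    · obtain ⟨m, hm⟩ : ∃ m : ℤ, Valued.v x = exp m := ⟨_, (exp_log h0).symm⟩
      rw [hm] at h1 h2 ⊢
      rw [exp_le_exp] at h1; rw [exp_lt_exp] at h2
      congr 1; omega

/-- **THE LEVEL-`a` GENERATORS, `a ≥ 1` (RamM)**: if `v_h + d_ρ + 2k₀ + 2j = 2a`, the `x₀ ∈ Mˣ` generating an integral Gram-primitive lattice of level `|ϖE|^a` are EXACTLY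
`α^{k₀}·{ω : |ω| = 1, |1 + (η·t(α^{k₀}))·t(ω)| = exp(2a − 2j − d_ρ)}`. [cite: Jacobowitz1962, §4] [cite: Flicker1998UnitaryFL, p. 84] -/
theorem setOf_levelGenR_eq_smul_of_pos (hρρ : ∀ x, ρ (ρ x) = x) (hvΘ : ∀ x, Valued.v (Θ x) = Valued.v x)
    (hfix : ∀ c : K, ρ c = c → c ≠ 0 → ∃ n : ℤ, Valued.v c = exp (2 * n)) (hρα : ρ α ≠ α)
    (hα : Valued.v α = exp (-1 : ℤ)) (hdρ : Valued.v (α - ρ α) = exp (-(dρ : ℤ))) (hϖE : Valued.v ϖE = exp (-2 : ℤ)) (hρϖ : ρ ϖE = ϖE) (hα0 : α ≠ 0)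
    (hh : h ≠ 0) {vh : ℤ} (hvh : Valued.v h = exp (-vh)) (j : ℕ) {a : ℕ} (ha : 1 ≤ a) {k₀ : ℤ} (hk₀ : vh + dρ + 2 * k₀ + 2 * j = 2 * a) :
    {x₀ : Kˣ |
        ((Valued.v (h * ((x₀ : K) * Θ x₀) * (ϖE ^ j * (α - ρ α))) ≤ 1 ∧
              Valued.v (h * ((x₀ : K) * Θ x₀) * (ϖE ^ j * (α - ρ α)) - ρ (h * ((x₀ : K) * Θ x₀) * (ϖE ^ j * (α - ρ α)))) ≤ Valued.v (ϖE ^ j * (α - ρ α))) ∧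
            ¬ (Valued.v (h * ((x₀ : K) * Θ x₀) * (ϖE ^ j * (α - ρ α)) / ϖE) ≤ 1 ∧
                Valued.v (h * ((x₀ : K) * Θ x₀) * (ϖE ^ j * (α - ρ α)) / ϖE - ρ (h * ((x₀ : K) * Θ x₀) * (ϖE ^ j * (α - ρ α)) / ϖE)) ≤
                  Valued.v (ϖE ^ j * (α - ρ α)))) ∧
          Valued.v (h * ((x₀ : K) * Θ x₀) * (ϖE ^ j * (α - ρ α))) = Valued.v ϖE ^ a} =
      (Units.mk0 α hα0 ^ k₀) • {ω : Kˣ | Valued.v (ω : K) = 1 ∧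
        Valued.v (1 + (ρ h / h * (ρ (α ^ k₀ * Θ (α ^ k₀)) / (α ^ k₀ * Θ (α ^ k₀)))) * (ρ ((ω : K) * Θ ω) / ((ω : K) * Θ ω))) =
          exp (2 * (a : ℤ) - 2 * j - dρ)} := by
  have hcoe : ∀ (ω : Kˣ), (((Units.mk0 α hα0 ^ k₀ * ω : Kˣ)) : K) = α ^ k₀ * ω := fun ω => by
    rw [Units.val_mul, Units.val_zpow_eq_zpow_val, Units.val_mk0]
  ext x₀
  rw [Set.mem_setOf_eq, Set.mem_smul_set]
  constructor
  · intro hP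
    obtain ⟨k, ω, hω, hx⟩ := exists_eq_uniformizer_zpow_mul_unit hα x₀.ne_zero
    rw [hx] at hP
    obtain ⟨hkj, hdep⟩ := (hermGenR_level_iff_of_pos hρρ hvΘ hfix hρα hα hdρ hϖE hρϖ hh hvh j ha hω).1 hP
    have hk : k = k₀ := by omega
    have hω0 : ω ≠ 0 := fun h0 => by rw [h0, map_zero] at hω; exact zero_ne_one hω
    refine ⟨Units.mk0 ω hω0, ⟨by rw [Units.val_mk0]; exact hω, ?_⟩, Units.ext ?_⟩
    · rw [Units.val_mk0, mul_assoc, ← hk]; exact hdep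
    · rw [smul_eq_mul, hcoe, Units.val_mk0, ← hk, ← hx]
  · rintro ⟨ω, ⟨hω, hdep⟩, rfl⟩
    rw [smul_eq_mul, hcoe]
    rw [mul_assoc] at hdep
    exact (hermGenR_level_iff_of_pos hρρ hvΘ hfix hρα hα hdρ hϖE hρϖ hh hvh j ha hω).2 ⟨hk₀, hdep⟩

/-- **THE LEVEL-`0` GENERATORS (RamM)**: with `v_h + d_ρ + 2k₀ + 2j = 0`, they are `α^{k₀}·{ω : |ω| = 1, |1 + (η·t(α^{k₀}))·t(ω)| ≤ exp(−(2j + d_ρ))}`. [cite: Jacobowitz1962, §4] -/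
theorem setOf_levelGenR_eq_smul_zero (hρρ : ∀ x, ρ (ρ x) = x) (hvΘ : ∀ x, Valued.v (Θ x) = Valued.v x)
    (hfix : ∀ c : K, ρ c = c → c ≠ 0 → ∃ n : ℤ, Valued.v c = exp (2 * n)) (hρα : ρ α ≠ α)
    (hα : Valued.v α = exp (-1 : ℤ)) (hdρ : Valued.v (α - ρ α) = exp (-(dρ : ℤ))) (hϖE : Valued.v ϖE = exp (-2 : ℤ)) (hρϖ : ρ ϖE = ϖE) (hα0 : α ≠ 0)
    (hh : h ≠ 0) {vh : ℤ} (hvh : Valued.v h = exp (-vh)) (j : ℕ) {k₀ : ℤ} (hk₀ : vh + dρ + 2 * k₀ + 2 * j = 0) :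
    {x₀ : Kˣ |
        ((Valued.v (h * ((x₀ : K) * Θ x₀) * (ϖE ^ j * (α - ρ α))) ≤ 1 ∧
              Valued.v (h * ((x₀ : K) * Θ x₀) * (ϖE ^ j * (α - ρ α)) - ρ (h * ((x₀ : K) * Θ x₀) * (ϖE ^ j * (α - ρ α)))) ≤ Valued.v (ϖE ^ j * (α - ρ α))) ∧
            ¬ (Valued.v (h * ((x₀ : K) * Θ x₀) * (ϖE ^ j * (α - ρ α)) / ϖE) ≤ 1 ∧
                Valued.v (h * ((x₀ : K) * Θ x₀) * (ϖE ^ j * (α - ρ α)) / ϖE - ρ (h * ((x₀ : K) * Θ x₀) * (ϖE ^ j * (α - ρ α)) / ϖE)) ≤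
                  Valued.v (ϖE ^ j * (α - ρ α)))) ∧
          Valued.v (h * ((x₀ : K) * Θ x₀) * (ϖE ^ j * (α - ρ α))) = Valued.v ϖE ^ (0 : ℕ)} =
      (Units.mk0 α hα0 ^ k₀) • {ω : Kˣ | Valued.v (ω : K) = 1 ∧
        Valued.v (1 + (ρ h / h * (ρ (α ^ k₀ * Θ (α ^ k₀)) / (α ^ k₀ * Θ (α ^ k₀)))) * (ρ ((ω : K) * Θ ω) / ((ω : K) * Θ ω))) ≤
          exp (-(2 * (j : ℤ) + dρ))} := by
  have hcoe : ∀ (ω : Kˣ), (((Units.mk0 α hα0 ^ k₀ * ω : Kˣ)) : K) = α ^ k₀ * ω := fun ω => by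
    rw [Units.val_mul, Units.val_zpow_eq_zpow_val, Units.val_mk0]
  ext x₀
  rw [Set.mem_setOf_eq, Set.mem_smul_set]
  constructor
  · intro hP
    obtain ⟨k, ω, hω, hx⟩ := exists_eq_uniformizer_zpow_mul_unit hα x₀.ne_zero
    rw [hx] at hP
    obtain ⟨hkj, hdep⟩ := (hermGenR_level_iff_zero hρρ hvΘ hfix hρα hα hdρ hϖE hρϖ hh hvh j hω).1 hP
    have hk : k = k₀ := by omega
    have hω0 : ω ≠ 0 := fun h0 => by rw [h0, map_zero] at hω; exact zero_ne_one hω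
    refine ⟨Units.mk0 ω hω0, ⟨by rw [Units.val_mk0]; exact hω, ?_⟩, Units.ext ?_⟩
    · rw [Units.val_mk0, mul_assoc, ← hk]; exact hdep
    · rw [smul_eq_mul, hcoe, Units.val_mk0, ← hk, ← hx]
  · rintro ⟨ω, ⟨hω, hdep⟩, rfl⟩
    rw [smul_eq_mul, hcoe]
    rw [mul_assoc] at hdep
    exact (hermGenR_level_iff_zero hρρ hvΘ hfix hρα hα hdρ hϖE hρϖ hh hvh j hω).2 ⟨hk₀, hdep⟩

/-- **NO SOLUTION OF THE LEVEL EQUATION: NO GENERATORS** — if `v_h + d_ρ + 2k + 2j ≠ 2a` for every `k` (e.g. `v_h + d_ρ` odd: then NO level is ever occupied — F0P3-p01 (g32) §A «an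
odd `v_M(h(α−ρα))` class carries no lattice at all»), no `x₀` generates a level-`a` member. [cite: Jacobowitz1962, §4] -/
theorem setOf_levelGenR_eq_empty_of_forall_ne (hvΘ : ∀ x, Valued.v (Θ x) = Valued.v x)
    (hα : Valued.v α = exp (-1 : ℤ)) (hdρ : Valued.v (α - ρ α) = exp (-(dρ : ℤ))) (hϖE : Valued.v ϖE = exp (-2 : ℤ)) {vh : ℤ} (hvh : Valued.v h = exp (-vh))
    (j a : ℕ) (hne : ∀ k : ℤ, vh + dρ + 2 * k + 2 * j ≠ 2 * a) :
    {x₀ : Kˣ |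
        ((Valued.v (h * ((x₀ : K) * Θ x₀) * (ϖE ^ j * (α - ρ α))) ≤ 1 ∧
              Valued.v (h * ((x₀ : K) * Θ x₀) * (ϖE ^ j * (α - ρ α)) - ρ (h * ((x₀ : K) * Θ x₀) * (ϖE ^ j * (α - ρ α)))) ≤ Valued.v (ϖE ^ j * (α - ρ α))) ∧
            ¬ (Valued.v (h * ((x₀ : K) * Θ x₀) * (ϖE ^ j * (α - ρ α)) / ϖE) ≤ 1 ∧
                Valued.v (h * ((x₀ : K) * Θ x₀) * (ϖE ^ j * (α - ρ α)) / ϖE - ρ (h * ((x₀ : K) * Θ x₀) * (ϖE ^ j * (α - ρ α)) / ϖE)) ≤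
                  Valued.v (ϖE ^ j * (α - ρ α)))) ∧
          Valued.v (h * ((x₀ : K) * Θ x₀) * (ϖE ^ j * (α - ρ α))) = Valued.v ϖE ^ a} = ∅ := by
  ext x₀
  simp only [Set.mem_setOf_eq, Set.mem_empty_iff_false, iff_false, not_and]
  intro _ hlev
  obtain ⟨k, ω, hω, hx⟩ := exists_eq_uniformizer_zpow_mul_unit hα x₀.ne_zero
  rw [hx, v_hermGenR_zpow_mul (ρ := ρ) hvΘ hα hdρ hϖE hvh j hω, v_varpiE_pow hϖE, exp_inj] at hlev
  exact hne k (by omega)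

/-- **THE EXACT-DEPTH SET IS A DIFFERENCE OF TWO DEPTH SETS**: `{|1 + c·t| = exp n} = {|1 + c·t| ≤ exp n} ∖ {|1 + c·t| ≤ exp(n − 1)}` (any multiplier `c`). [cite: Serre1979, Ch. V §1] -/
theorem setOf_twistDepth_eq_diff (c : K) (n : ℤ) :
    {ω : Kˣ | Valued.v (ω : K) = 1 ∧ Valued.v (1 + c * (ρ ((ω : K) * Θ ω) / ((ω : K) * Θ ω))) = exp n} =
      {ω : Kˣ | Valued.v (ω : K) = 1 ∧ Valued.v (1 + c * (ρ ((ω : K) * Θ ω) / ((ω : K) * Θ ω))) ≤ exp n} \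
        {ω : Kˣ | Valued.v (ω : K) = 1 ∧ Valued.v (1 + c * (ρ ((ω : K) * Θ ω) / ((ω : K) * Θ ω))) ≤ exp (n - 1)} := by
  ext ω
  simp only [Set.mem_setOf_eq, Set.mem_sdiff, not_and]
  rw [v_eq_exp_iff_le_and_not_le]
  constructor
  · rintro ⟨hω, hle, hnot⟩; exact ⟨⟨hω, hle⟩, fun _ => hnot⟩
  · rintro ⟨⟨hω, hle⟩, hnot⟩; exact ⟨hω, hle, hnot hω⟩

end Literature.NumberTheory.LocalFields.QuadraticOrder
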